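import Mathlib.FieldTheory.Galois.Infinite
import Literature.NumberTheory.GaloisCohomology.PoitouTateRealPlacesHigherDegree
import Literature.NumberTheory.GaloisRepresentations.ContinuousCarryTwoCocycle
import Literature.NumberTheory.GaloisRepresentations.ContinuousH2OrderTwoCriterion
import Literature.NumberTheory.GaloisRepresentations.AbsGaloisRestrictRealPlace
import Literature.NumberTheory.GaloisRepresentations.KummerSignCharacter
import Literature.NumberTheory.GaloisRepresentations.ContinuousShapiroLiftCores
import Literature.NumberTheory.NumberFields.PrescribedSignsAtRealPlaces
import HarnessLib

/-!
# `H²(K, M) → ⊕_{v real} H²(K_v, M)` is surjective (Milne, *ADT* I Cor. 4.16) — proof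

This file PROVES the tree's named fact `poitouTate_two_realPlaces_surjective K`
(`PoitouTateRealPlacesHigherDegree.lean`; Milne, *Arithmetic Duality Theorems* I Cor. 4.16, second
sentence; Harari Thm. 17.13; Tate ICM 1962 Thm. 3.1): for every number field `K` and every finite
discrete `Γ_K`-module `M`, every family of local classes `(r_w ∈ H²(K_w, M))_w` at the infinite places
is, at the REAL places, the family of localisations of one global class (`poitouTate_two_realPlaces_surjective_holds`).

Unlike the degree-`1` analogue (orthogonal, in the Poitou–Tate sequence, to the classes of
`H¹(K, M^D)` locally trivial at the finite places — a Chebotarev statement), this one is elementary: in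
the Poitou–Tate sequence it is orthogonal to `H⁰(K, M^D)`, and we give a direct cochain-level proof
by corestriction of a Bockstein, written out as the tree's **carry cocycle**
(`ContinuousCarryTwoCocycle.lean`).  For a real place `w₀`, `c₀ ∈ Γ_K` the complex conjugation that
is the image of the non-trivial element of `Γ_{K_{w₀}}` (`AbsGaloisRestrictRealPlace.lean`), and a
target class with normalised diagonal `m ∈ M^{c₀}` (`ContinuousH2OrderTwoCriterion.lean`:
`H²(Γ_{K_w}, M) ≅ M^{c}/(1 + c)M`), let `N = Stab_{Γ_K}(m)` (open, `c₀ ∈ N`), `F = K̄^N` (a number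
field), and for each pair `(w, x)` of a real place and a coset `x ∈ Γ_K/N` fixed by `c_w` let
`ψ_{w,x} : F → ℝ`, `ψ_{w,x}(b) = ι_w(s(x) b)`, be the attached real embedding (`ι_w : K̄ → ℂ` the
embedding under which `c_w` is complex conjugation, `s` coset representatives) — distinct pairs give
distinct real places of `F`.  Weak approximation (`PrescribedSignsAtRealPlaces.lean`) gives `b ∈ F`
negative at `ψ_{w₀,1}` and positive at every other `ψ_{w,x}`; the Kummer sign character `χ_b` of `√b`
on `N` (`KummerSignCharacter.lean`) then has `χ_b(s(x)⁻¹ c_w s(x)) = -1` exactly for `(w, x) = (w₀, 1)`,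
so the carry cocycle `X_{χ_b, m}` has diagonal `≡ m` at `c₀` and `≡ 0 mod (1 + c_w)M` at every other
real place: its class localises to the target at `w₀` and to `0` elsewhere
(`exists_localization_inl_eq_single`).  Summing over the real places gives the fact.

No sorry, no new axiom; the only inputs are the tree files imported above and Mathlib (infinite Galois
correspondence `InfiniteGalois.fixingSubgroup_fixedField`, `isOpen_iff_finite`).

## References

* J. S. Milne, *Arithmetic Duality Theorems*, 2nd ed. (2006), I Cor. 4.16 (p. 62), I §4 p. 55
  (archimedean conventions), I Thm. 2.13 (a). [MilneADT2006]
* D. Harari, *Galois Cohomology and Class Field Theory* (2020), Thm. 17.13 (c). [Harari2020]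
* J. Neukirch, A. Schmidt, K. Wingberg, *Cohomology of Number Fields* (2008), I §5 (corestriction on
  cochains). [NeukirchSchmidtWingberg2008]
-/

noncomputable section

open NumberField Field Function

namespace Literature.NumberTheory.GaloisCohomology

open Literature.NumberTheory.GaloisRepresentations
open Literature.NumberTheory.EllipticCurves (schreierElt schreierElt_mem schreierElt_coe)

-- The cochain models of `H²` need `LocallyCompactSpace Γ`, supplied by compactness (every field).
attribute [local instance] absoluteGaloisGroup_compactSpace

variable {K : Type} [Field K] [NumberField K]
variable {M : Type} [AddCommGroup M] [TopologicalSpace M] [DiscreteTopology M]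

/-! ### The stabiliser of a vector -/

omit [NumberField K] in
/-- The stabiliser `Stab_{Γ_K}(m) = {g | g m = m}` of a vector of a discrete Galois module, as a
subgroup (open: `ContinuousRep.isOpen_setOf_apply_eq`). [cite: MilneADT2006, Ch. I §4 (p. 55)] -/
def stabilizerSubgroup (ρ : DiscreteGaloisModule K M) (m : M) : Subgroup (absoluteGaloisGroup K) where
  carrier := {g | ρ g m = m}
  one_mem' := by
    change ρ 1 m = m
    rw [map_one]; rfl
  mul_mem' {g h} hg hh := by
    change ρ (g * h) m = m
    change ρ g m = m at hg
    change ρ h m = m at hh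
    rw [map_mul, Module.End.mul_apply, hh, hg]
  inv_mem' {g} hg := by
    change ρ g⁻¹ m = m
    change ρ g m = m at hg
    conv_lhs => rw [← hg]
    rw [← Module.End.mul_apply, ← map_mul, inv_mul_cancel, map_one, Module.End.one_apply]

omit [NumberField K] in
/-- Membership in the stabiliser. [cite: MilneADT2006, Ch. I §4 (p. 55)] -/
theorem mem_stabilizerSubgroup_iff (ρ : DiscreteGaloisModule K M) (m : M) (g : absoluteGaloisGroup K) :
    g ∈ stabilizerSubgroup ρ m ↔ ρ g m = m := Iff.rfl

omit [NumberField K] in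
/-- The stabiliser is open. [cite: MilneADT2006, Ch. I §4 (p. 55)] -/
theorem isOpen_stabilizerSubgroup (ρ : DiscreteGaloisModule K M) (m : M) :
    IsOpen (stabilizerSubgroup ρ m : Set (absoluteGaloisGroup K)) :=
  ContinuousRep.isOpen_setOf_apply_eq ρ m

/-! ### Localisation of the class of an explicit `2`-cocycle at an infinite place -/

/-- The restriction of a continuous `2`-cocycle of `Γ_K` to `Γ_{K_w}` along `absGaloisRestrict`
(`(σ, τ) ↦ f(res σ, res τ)`). [cite: MilneADT2006, Ch. I §4 (p. 55)] -/
def resTwoInl (ρ : DiscreteGaloisModule K M) (w : InfinitePlace K) (f : contTwoCocycles ρ.toTopRep) :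
    contTwoCocycles (ρ.toLocal (Sum.inl w)).toTopRep :=
  contTwoCocycles.pullback (absGaloisRestrict K (Place.Completion (K := K) (Sum.inl w))) (X := ρ.toTopRep)
    (Y := (ρ.toLocal (Sum.inl w)).toTopRep)
    (_root_.TopRep.ofHom ⟨ContinuousLinearMap.id ℤ M, fun _ => rfl⟩) f

/-- Values of `resTwoInl`. [cite: MilneADT2006, Ch. I §4 (p. 55)] -/
@[simp] theorem resTwoInl_apply (ρ : DiscreteGaloisModule K M) (w : InfinitePlace K)
    (f : contTwoCocycles ρ.toTopRep) (σ τ : absoluteGaloisGroup (Place.Completion (K := K) (Sum.inl w))) :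
    (resTwoInl ρ w f).1 (σ, τ) =
      f.1 (absGaloisRestrict K (Place.Completion (K := K) (Sum.inl w)) σ,
        absGaloisRestrict K (Place.Completion (K := K) (Sum.inl w)) τ) := rfl

/-- **`loc_w [f] = [f ∘ (res × res)]`** on `H²` (`map_twoCocycleClass`). [cite: MilneADT2006, Ch. I §4 (p. 55)] -/
theorem localization_inl_twoCocycleClass (ρ : DiscreteGaloisModule K M) (w : InfinitePlace K)
    (f : contTwoCocycles ρ.toTopRep) :
    galoisCohomology.localization ρ (Sum.inl w) 2 (twoCocycleClass _ f) =
      twoCocycleClass _ (resTwoInl ρ w f) :=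
  map_twoCocycleClass (absGaloisRestrict K (Place.Completion (K := K) (Sum.inl w))) (X := ρ.toTopRep)
    (Y := (ρ.toLocal (Sum.inl w)).toTopRep)
    (_root_.TopRep.ofHom ⟨ContinuousLinearMap.id ℤ M, fun _ => rfl⟩) f

/-! ### The construction at one real place -/

section OnePlace

variable (ρ : DiscreteGaloisModule K M)

/-- **Key lemma: a class at ONE real place, zero at the others.**  For a real place `w₀` and a class
`t ∈ H²(K_{w₀}, M)` (`M` any discrete `Γ_K`-module, not necessarily finite) there is `c ∈ H²(K, M)`
with `loc_{w₀} c = t` and `loc_w c = 0` at every other real place `w` (construction in the module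
docstring: carry cocycle of the Kummer sign character of an element of `K̄^{Stab(m)}` with prescribed
signs). [cite: MilneADT2006, Ch. I, Cor. 4.16 (p. 62)]
[cite: NeukirchSchmidtWingberg2008, I §5] -/
theorem exists_localization_inl_eq_single {w₀ : InfinitePlace K} (hw₀ : w₀.IsReal)
    (t : galoisCohomology (ρ.toLocal (Sum.inl w₀)) 2) :
    ∃ c : galoisCohomology ρ 2, galoisCohomology.localization ρ (Sum.inl w₀) 2 c = t ∧
      ∀ w : InfinitePlace K, w.IsReal → w ≠ w₀ → galoisCohomology.localization ρ (Sum.inl w) 2 c = 0 := by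
  classical
  /- Step 1: the complex conjugations `c_w = res σ_w` and the embeddings `ι_w`. -/
  have hex : ∀ w : InfinitePlace K, w.IsReal →
      ∃ σ : absoluteGaloisGroup (Place.Completion (K := K) (Sum.inl w)), σ ≠ 1 ∧
        ∀ τ : absoluteGaloisGroup (Place.Completion (K := K) (Sum.inl w)), τ = 1 ∨ τ = σ :=
    fun w hw => exists_ne_one_forall_eq_of_isReal hw
  choose σ hσne hσall using hex
  -- the images in `Γ_K`
  set cc : ∀ w : InfinitePlace K, w.IsReal → absoluteGaloisGroup K :=
    fun w hw => absGaloisRestrict K (Place.Completion (K := K) (Sum.inl w)) (σ w hw) with hcc_def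
  have hcc_conj : ∀ w hw, IsComplexConjugationAt hw (cc w hw) := fun w hw =>
    isComplexConjugationAt_absGaloisRestrict_of_ne_one hw (hσne w hw)
  have hcc_mul : ∀ w hw, cc w hw * cc w hw = 1 := fun w hw =>
    absGaloisRestrict_mul_self_of_isReal hw (hσne w hw)
  have hσσ : ∀ w hw, σ w hw * σ w hw = 1 := by
    intro w hw
    haveI := finite_absoluteGaloisGroup_completion_infinitePlace w
    exact mul_self_eq_one_of_natCard_le_two
      (natCard_absoluteGaloisGroup_completion_infinitePlace_le_two w) (σ w hw)
  have hex2 : ∀ w : InfinitePlace K, ∀ hw : w.IsReal, ∃ ι : AlgebraicClosure K →+* ℂ,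
      ι.comp (algebraMap K (AlgebraicClosure K)) = w.embedding ∧
        ∀ z, ι (cc w hw • z) = starRingEnd ℂ (ι z) := by
    intro w hw
    obtain ⟨ι, hover, hconj⟩ := (isComplexConjugationAt_iff hw _).1 (hcc_conj w hw)
    refine ⟨ι, hover.over, fun z => ?_⟩
    rw [absoluteGaloisGroup.smul_def]
    exact hconj.eq z
  choose ι hιK hιc using hex2
  /- Step 2: the target class and the vector `m ∈ M^{c₀}`. -/
  obtain ⟨φ₀, rfl⟩ := twoCocycleClass_surjective (ρ.toLocal (Sum.inl w₀)).toTopRep t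
  set m : M := twoCocycleNormDiag (X := (ρ.toLocal (Sum.inl w₀)).toTopRep) (σ w₀ hw₀) φ₀ with hm_def
  have hm_fix : ρ (cc w₀ hw₀) m = m := by
    have h := rho_twoCocycleNormDiag (X := (ρ.toLocal (Sum.inl w₀)).toTopRep) (hσσ w₀ hw₀) φ₀
    exact h
  /- Step 3: the open subgroup `N = Stab(m)`, coset representatives, the fixed field `F = K̄^N`. -/
  set N : Subgroup (absoluteGaloisGroup K) := stabilizerSubgroup ρ m with hN_def
  have hN : IsOpen (N : Set (absoluteGaloisGroup K)) := isOpen_stabilizerSubgroup ρ m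
  have hcN : cc w₀ hw₀ ∈ N := hm_fix
  haveI : Finite (absoluteGaloisGroup K ⧸ N) := Subgroup.quotient_finite_of_isOpen N hN
  letI : Fintype (absoluteGaloisGroup K ⧸ N) := Fintype.ofFinite _
  obtain ⟨s, hs, hs1⟩ := exists_reps_one (G := absoluteGaloisGroup K) N
  have hmN : ∀ n : N, ρ.toTopRep.ρ (n : absoluteGaloisGroup K) m = m := fun n => n.2
  -- the fixed field
  set NA : Subgroup (AlgebraicClosure K ≃ₐ[K] AlgebraicClosure K) :=
    N.comap (absoluteGaloisGroup.toAlgEquiv K).symm.toMonoidHom with hNA_def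
  have hmemNA : ∀ g : absoluteGaloisGroup K, absoluteGaloisGroup.toAlgEquiv K g ∈ NA ↔ g ∈ N :=
    fun g => Iff.rfl
  set F : IntermediateField K (AlgebraicClosure K) := IntermediateField.fixedField NA with hF_def
  have hFfix : ∀ n : absoluteGaloisGroup K, n ∈ N → ∀ x : AlgebraicClosure K, x ∈ F → n • x = x := by
    intro n hn x hx
    rw [hF_def, IntermediateField.mem_fixedField_iff] at hx
    rw [absoluteGaloisGroup.smul_def]
    exact hx _ ((hmemNA n).2 hn)
  have hNAclosed : IsClosed (NA : Set (AlgebraicClosure K ≃ₐ[K] AlgebraicClosure K)) :=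
    Subgroup.isClosed_of_isOpen N hN
  have hGal : F.fixingSubgroup = NA :=
    InfiniteGalois.fixingSubgroup_fixedField ⟨NA, hNAclosed⟩
  have hmemN_of_fix : ∀ g : absoluteGaloisGroup K, (∀ x : AlgebraicClosure K, x ∈ F → g • x = x) →
      g ∈ N := by
    intro g hg
    have h : absoluteGaloisGroup.toAlgEquiv K g ∈ F.fixingSubgroup :=
      (IntermediateField.mem_fixingSubgroup_iff _ _).2 fun x hx => hg x hx
    rw [hGal] at h
    exact (hmemNA g).1 h
  haveI hFfd : FiniteDimensional K F := (InfiniteGalois.isOpen_iff_finite F).1 (by rw [hGal]; exact hN)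
  haveI : NumberField F := NumberField.of_module_finite (K := K) (L := F)
  /- Step 4: the real embeddings `ψ_{w,x}(b) = ι_w (s(x) • b)` of `F` and their places. -/
  set ψ : ∀ w : InfinitePlace K, w.IsReal → (absoluteGaloisGroup K ⧸ N) → (F →+* ℂ) :=
    fun w hw x => (ι w hw).comp ((MulSemiringAction.toRingHom (absoluteGaloisGroup K)
      (AlgebraicClosure K) (s x)).comp (algebraMap F (AlgebraicClosure K))) with hψ_def
  have hψ_apply : ∀ w hw x (b : F), ψ w hw x b = ι w hw (s x • (b : AlgebraicClosure K)) :=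
    fun _ _ _ _ => rfl
  -- fixed cosets give Schreier elements `s(x)⁻¹ c s(x) ∈ N`
  have hfixN : ∀ w hw (x : absoluteGaloisGroup K ⧸ N), cc w hw • x = x →
      (s x)⁻¹ * cc w hw * s x ∈ N := by
    intro w hw x hx
    have h := schreierElt_mem N hs (cc w hw) x
    rwa [hx] at h
  have hψreal : ∀ w hw x, cc w hw • x = x → ComplexEmbedding.IsReal (ψ w hw x) := by
    intro w hw x hx
    rw [ComplexEmbedding.isReal_iff]
    ext1 b
    rw [ComplexEmbedding.conjugate_coe_eq, hψ_apply, ← hιc]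
    congr 1
    have h := hFfix _ (hfixN w hw x hx) (b : AlgebraicClosure K) b.2
    -- `c • s(x) • b = s(x) • ((s x)⁻¹ c s(x)) • b = s(x) • b`
    conv_rhs => rw [← h]
    rw [← mul_smul, ← mul_smul]
    congr 1
    group
  have hψK : ∀ w hw x (k : K), ψ w hw x (algebraMap K F k) = w.embedding k := by
    intro w hw x k
    have hk : ((algebraMap K F k : F) : AlgebraicClosure K) = algebraMap K (AlgebraicClosure K) k := rfl
    rw [hψ_apply, hk, absoluteGaloisGroup.smul_def, AlgEquiv.commutes, ← RingHom.comp_apply, hιK]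
  -- the real places `W_{w,x}` and their injectivity on fixed pairs
  set W : ∀ w : InfinitePlace K, w.IsReal → (absoluteGaloisGroup K ⧸ N) → InfinitePlace F :=
    fun w hw x => InfinitePlace.mk (ψ w hw x) with hW_def
  have hWinj : ∀ w hw x w' hw' x', cc w hw • x = x → cc w' hw' • x' = x' →
      W w hw x = W w' hw' x' → w = w' ∧ x = x' := by
    intro w hw x w' hw' x' hx hx' hWW
    have hψψ : ψ w hw x = ψ w' hw' x' := by
      rcases InfinitePlace.mk_eq_iff.1 hWW with h | h
      · exact h
      · rwa [ComplexEmbedding.isReal_iff.1 (hψreal w hw x hx)] at h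
    have hww : w = w' := by
      have h : w.embedding = w'.embedding := by
        ext1 k
        rw [← hψK w hw x k, ← hψK w' hw' x' k, hψψ]
      rw [← InfinitePlace.mk_embedding w, h, InfinitePlace.mk_embedding]
    subst hww
    refine ⟨rfl, ?_⟩
    -- same `ι`: `s(x) • b = s(x') • b` on `F`, so `(s x)⁻¹ s x' ∈ N`
    have hfix : ∀ b : AlgebraicClosure K, b ∈ F → ((s x)⁻¹ * s x') • b = b := by
      intro b hb
      have h := congrArg (fun f : F →+* ℂ => f ⟨b, hb⟩) hψψ
      simp only [hψ_apply] at h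
      have h' : s x • b = s x' • b := (ι w hw).injective h
      rw [mul_smul, ← h', ← mul_smul, inv_mul_cancel, one_smul]
    have hmem := hmemN_of_fix _ hfix
    rw [← hs x, ← hs x']
    exact QuotientGroup.eq.2 hmem
  /- Step 5: an element of `F` negative at `W_{w₀,1}` and positive at every other real place. -/
  set x₁ : absoluteGaloisGroup K ⧸ N := ((1 : absoluteGaloisGroup K) : absoluteGaloisGroup K ⧸ N)
    with hx₁
  have hx₁fix : cc w₀ hw₀ • x₁ = x₁ := smul_mk_one_of_mem N hcN
  obtain ⟨b, hb0, hbsign⟩ :=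
    Literature.NumberTheory.NumberFields.exists_forall_isReal_sign F {W w₀ hw₀ x₁}
  -- reading the signs through `ψ`
  have hsign_read : ∀ w hw x (hx : cc w hw • x = x),
      InfinitePlace.Completion.extensionEmbeddingOfIsReal
          (InfinitePlace.isReal_mk_iff.2 (hψreal w hw x hx)) (algebraMap F (W w hw x).Completion b) =
        (ψ w hw x b).re := by
    intro w hw x hx
    have hreal := hψreal w hw x hx
    have hW : (W w hw x).IsReal := InfinitePlace.isReal_mk_iff.2 hreal
    rw [InfinitePlace.Completion.algebraMap_apply]
    have h1 : InfinitePlace.Completion.extensionEmbeddingOfIsReal hW (b : (W w hw x).Completion) =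
        InfinitePlace.embedding_of_isReal hW b :=
      InfinitePlace.Completion.extensionEmbeddingOfIsReal_coe hW (WithAbs.toAbs (W w hw x).1 b)
    rw [h1]
    have h2 : ((InfinitePlace.embedding_of_isReal hW b : ℝ) : ℂ) = (W w hw x).embedding b :=
      InfinitePlace.embedding_of_isReal_apply hW b
    have h3 : (W w hw x).embedding = ψ w hw x := InfinitePlace.embedding_mk_eq_of_isReal hreal
    rw [h3] at h2
    rw [← h2, Complex.ofReal_re]
  have hneg : (ψ w₀ hw₀ x₁ b).re < 0 := by
    rw [← hsign_read w₀ hw₀ x₁ hx₁fix]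
    exact ((hbsign (W w₀ hw₀ x₁) (InfinitePlace.isReal_mk_iff.2 (hψreal w₀ hw₀ x₁ hx₁fix))).1
      (Set.mem_singleton _))
  have hpos : ∀ w hw x (hx : cc w hw • x = x), W w hw x ≠ W w₀ hw₀ x₁ → 0 < (ψ w hw x b).re := by
    intro w hw x hx hne
    rw [← hsign_read w hw x hx]
    exact (hbsign (W w hw x) (InfinitePlace.isReal_mk_iff.2 (hψreal w hw x hx))).2
      (by rwa [Set.mem_singleton_iff])
  /- Step 6: the Kummer sign character of `b` on `N` and the carry cocycle. -/
  set a : AlgebraicClosure K := ((b : F) : AlgebraicClosure K) with ha_def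
  have ha0 : a ≠ 0 := by
    rw [ha_def]
    exact_mod_cast hb0
  have haN : ∀ n ∈ N, n • a = a := fun n hn => hFfix n hn a b.2
  set χ := kummerSign a ha0 N haN with hχ_def
  have hχ : Continuous χ := continuous_kummerSign a ha0 N haN
  set X := schreierCarryCocycle ρ.toTopRep N hs χ m hN hχ hmN with hX_def
  -- values of the signs at the Schreier elements of fixed cosets
  have hsign_fixed : ∀ w hw x (hx : cc w hw • x = x), W w hw x ≠ W w₀ hw₀ x₁ →
      schreierSign N hs χ (cc w hw) x = 0 := by
    intro w hw x hx hne
    rw [schreierSign_def]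
    -- the embedding `ι_w ∘ s(x)` makes `s(x)⁻¹ c_w s(x)` a complex conjugation
    set ι' : AlgebraicClosure K →+* ℂ :=
      (ι w hw).comp (MulSemiringAction.toRingHom (absoluteGaloisGroup K) (AlgebraicClosure K) (s x))
    have hι' : ∀ z, ι' ((schreierElt N hs (cc w hw) x : absoluteGaloisGroup K) • z) =
        starRingEnd ℂ (ι' z) := by
      intro z
      change ι w hw (s x • ((schreierElt N hs (cc w hw) x : absoluteGaloisGroup K) • z)) =
        starRingEnd ℂ (ι w hw (s x • z))
      rw [← hιc, schreierElt_coe_of_smul_eq N hs hx, ← mul_smul, ← mul_smul]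
      congr 2
      group
    rw [toAdd_kummerSign_eq_zero_iff_re_pos a ha0 N haN _ ι' hι']
    exact hpos w hw x hx hne
  have hsign_one : schreierSign N hs χ (cc w₀ hw₀) x₁ = 1 := by
    rw [schreierSign_def]
    have hι' : ∀ z, ι w₀ hw₀ ((schreierElt N hs (cc w₀ hw₀) x₁ : absoluteGaloisGroup K) • z) =
        starRingEnd ℂ (ι w₀ hw₀ z) := by
      intro z
      rw [schreierElt_coe_of_smul_eq N hs hx₁fix, hx₁, hs1, inv_one, one_mul, mul_one]
      exact hιc w₀ hw₀ z
    rw [toAdd_kummerSign_eq_one_iff_re_lt_zero a ha0 N haN _ (ι w₀ hw₀) hι']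
    have h := hneg
    rwa [hψ_apply, hx₁, hs1, one_smul] at h
  /- Step 7: the global class and its localisations. -/
  refine ⟨twoCocycleClass _ X, ?_, ?_⟩
  · -- at `w₀`: normalised diagonal `m + (y + c₀ y)` versus `m`
    rw [localization_inl_twoCocycleClass]
    haveI := finite_absoluteGaloisGroup_completion_infinitePlace w₀
    have hG := natCard_absoluteGaloisGroup_completion_infinitePlace_le_two w₀
    obtain ⟨y, hy⟩ := schreierCarryCocycle_diag_of_unit ρ.toTopRep N hs χ m (hN := hN) (hχ := hχ)
      (hm := hmN) (hcc_mul w₀ hw₀) hsign_one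
      (fun x hx hne => hsign_fixed w₀ hw₀ x hx (fun h => hne (hWinj _ _ _ _ _ _ hx hx₁fix h).2)) hcN
    refine twoCocycleClass_eq_of_twoCocycleNormDiag_sub_eq hG (hσne w₀ hw₀) _ _ (y := y) ?_
    have hy' : X.1 (cc w₀ hw₀, cc w₀ hw₀) = m + (y + ρ (cc w₀ hw₀) y) := hy
    have h11 : X.1 (1, 1) = 0 := schreierCarryCocycle_one_one ρ.toTopRep N hs χ m
    change X.1 (cc w₀ hw₀, cc w₀ hw₀) -
        ρ (cc w₀ hw₀) (X.1 (absGaloisRestrict K (Place.Completion (K := K) (Sum.inl w₀)) 1,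
          absGaloisRestrict K (Place.Completion (K := K) (Sum.inl w₀)) 1)) - m = y + ρ (cc w₀ hw₀) y
    rw [map_one, h11, map_zero, sub_zero, hy']
    abel
  · -- at `w ≠ w₀`: normalised diagonal is a norm
    intro w hw hne
    rw [localization_inl_twoCocycleClass]
    haveI := finite_absoluteGaloisGroup_completion_infinitePlace w
    have hG := natCard_absoluteGaloisGroup_completion_infinitePlace_le_two w
    obtain ⟨y, hy⟩ := schreierCarryCocycle_diag_of_forall_fixed ρ.toTopRep N hs χ m (hN := hN)
      (hχ := hχ) (hm := hmN) (hcc_mul w hw)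
      (fun x hx => hsign_fixed w hw x hx (fun h => hne (hWinj _ _ _ _ _ _ hx hx₁fix h).1))
    refine twoCocycleClass_eq_zero_of_twoCocycleNormDiag_eq hG (hσne w hw) _ (y := y) ?_
    have hy' : X.1 (cc w hw, cc w hw) = y + ρ (cc w hw) y := hy
    have h11 : X.1 (1, 1) = 0 := schreierCarryCocycle_one_one ρ.toTopRep N hs χ m
    change X.1 (cc w hw, cc w hw) -
        ρ (cc w hw) (X.1 (absGaloisRestrict K (Place.Completion (K := K) (Sum.inl w)) 1,
          absGaloisRestrict K (Place.Completion (K := K) (Sum.inl w)) 1)) = y + ρ (cc w hw) y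
    rw [map_one, h11, map_zero, sub_zero, hy']

end OnePlace

/-! ### The theorem -/

/-- **`H²(K, M) → ⊕_{v real} H²(K_v, M)` is surjective** for every number field `K` and every finite
discrete `Γ_K`-module `M` (Milne, *ADT* I Cor. 4.16, second sentence; Harari Thm. 17.13 (c)): the
tree's named fact `poitouTate_two_realPlaces_surjective K` HOLDS.  Proof: sum over the real places
`w₀` of the classes of `exists_localization_inl_eq_single` for the components `r_{w₀}`.
[cite: MilneADT2006, Ch. I, Cor. 4.16 (p. 62)] [cite: Harari2020, Thm. 17.13 (c) (p. 294)] -/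
theorem poitouTate_two_realPlaces_surjective_holds :
    ∀ (K : Type) [Field K] [NumberField K], poitouTate_two_realPlaces_surjective K := by
  intro K _ _ M _ _ _ _ ρ r
  classical
  -- one class per real place
  have h : ∀ w₀ : InfinitePlace K, ∃ c : galoisCohomology ρ 2,
      (w₀.IsReal → galoisCohomology.localization ρ (Sum.inl w₀) 2 c = r w₀) ∧
      ∀ w : InfinitePlace K, w.IsReal → w ≠ w₀ → galoisCohomology.localization ρ (Sum.inl w) 2 c = 0 := by
    intro w₀
    by_cases hw₀ : w₀.IsReal
    · obtain ⟨c, hc, hc'⟩ := exists_localization_inl_eq_single ρ hw₀ (r w₀)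
      exact ⟨c, fun _ => hc, hc'⟩
    · exact ⟨0, fun h => absurd h hw₀, fun w _ _ => map_zero _⟩
  choose c hc hc' using h
  refine ⟨∑ w₀ : InfinitePlace K, c w₀, fun w hw => ?_⟩
  rw [map_sum, Finset.sum_eq_single w]
  · exact hc w hw
  · intro w₀ _ hne
    exact hc' w₀ w hw (Ne.symm hne)
  · intro h
    exact absurd (Finset.mem_univ w) h

end Literature.NumberTheory.GaloisCohomology

end
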